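import Summits.HodgeConjecture.HodgeConjecture.Cruxes.BlochSeedDiscOne.FinCheck

/-!
# HubCover — the hub `H = (6;0,0)` is the UNIVERSAL cover letter at h = 6; `H⁴` is live above every P cell of every (A4) design (negation g19, pen; `COVER-INTEGRALITY-JOINT.md` v1.5 §C.13: why the spines of the OT-BB v3 trees END in hub classes `H⁴, H³F, H²F², H³z, H²Fz, H²z²` — all-AXIS N cells over H = (6;0,0), F = (5;1,0), z = (4;2,0); s4's bus line l.11537 letters them «H³t, H²t², H²tz» with its t = (5;1,0))

LETTER FACTS (kernel `decide` over `FinCheck.boxList 6 6`, transported by `mem_boxList`):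
* `hub_above` — every alphabet letter that is OFF-AXIS (`x ≠ 0`, `y ≠ 0`) with `a ≤ 4` lies amply below `H = (6;0,0)`; with
  `FinCheck.p_letter_offaxis` ∕ `p_letter_le` (every P letter of an (A4) design is off-axis with `a ≤ h − 2 = 4`) this gives
* `hub4_live : ∀ D, D.OnAlphabet 6 → D.A4 → ∀ x ∈ D.suppP, Live x hub4` — the constant hub cell `H⁴` is LIVE ABOVE EVERY PRESENT P CELL;
  and `a4P_of_hub4`: for a design with `H⁴ ∈ suppN` the P-half of (A4) is EQUIVALENT to «every P letter is off-axis with a ≤ 4»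
  (it carries no further information), and a cover row `x_π ≤ B·Σ{x_ν : ν above π}` always has `H⁴` among the partners ν.
* `subhub_above` — the sub-hub `F = (5;1,0)`-shape covers every off-axis letter with `a ≤ 3` (everything P-able except the a-letters
  `(4;±1,±1)`, whose only cover is `H`: `LetterSides.above_a`).
* `below_hub_offaxis` — conversely every letter amply below `H` is off-axis with `a ≤ 4` (so BELOW(H) = exactly the P-able shapes).
READING (memo v1.5 §C.13, census-neutral): hub N cells are everybody's partner, so cover ∕ agg-cover rows can never price them out —
only the e-free ∕ mass rows do; that is why v3's partner-mass rule meets them LAST and why they open only 1-node subtrees.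
Imports `FinCheck` only; sorry-free; no `native_decide`; no instances; no notation.
HONEST FRAMING: finite LETTER-model facts at h = 6 and a one-line consequence of `Design.A4`; nothing here proves
`FloorFree 6 199 8` ∕ `IntegralityGap.Nonex 14 199 8` ∕ 18881 (`BlochSeedDiscOne`) ∕ H2 ∕ HC_AV ∕ HC_CM ∕ HC.
-/

set_option linter.dupNamespace false
set_option autoImplicit false

namespace Summit.HodgeConjecture.HodgeConjecture.Cruxes.BlochSeedDiscOne.HubCover

open Summit.HodgeConjecture.HodgeConjecture.Cruxes.BlochSeedDiscOne.DepthBoundA4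
open Summit.HodgeConjecture.HodgeConjecture.Cruxes.BlochSeedDiscOne.FinCheck

/-- the hub letter `H = (6;0,0)`. -/
def hub : Letter := ⟨6, 0, 0⟩

/-- the hub cell `H⁴`. -/
def hub4 : Cell := fun _ => hub

/-- an alphabet letter is a box letter (transport helper). -/
theorem alphabet_mem_boxList {ℓ : Letter} (hℓ : ℓ.OnAlphabet 6) : ℓ ∈ boxList 6 6 := by
  refine mem_boxList.mpr ⟨hℓ.1, ?_, ?_⟩
  · have e := hℓ.1; have h0 := hℓ.2; unfold Letter.height at e
    have := abs_nonneg ℓ.y; push_cast; omega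
  · have e := hℓ.1; have h0 := hℓ.2; unfold Letter.height at e
    have := abs_nonneg ℓ.x; push_cast; omega

set_option maxRecDepth 65536 in
/-- list form: every off-axis box letter of height 6 with `0 ≤ a ≤ 4` is amply below the hub. -/
theorem hub_above_list : ∀ ℓ ∈ boxList 6 6, 0 ≤ ℓ.a → ℓ.a ≤ 4 → ℓ.x ≠ 0 → ℓ.y ≠ 0 → AmpleAbove ℓ hub := by
  decide

/-- **the hub is the universal cover letter**: every off-axis alphabet letter with `a ≤ 4` lies amply below `H = (6;0,0)`. -/
theorem hub_above : ∀ ℓ : Letter, ℓ.OnAlphabet 6 → ℓ.a ≤ 4 → ℓ.x ≠ 0 → ℓ.y ≠ 0 → AmpleAbove ℓ hub := by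
  intro ℓ hℓ h4 hx hy
  exact hub_above_list ℓ (alphabet_mem_boxList hℓ) hℓ.2 h4 hx hy

set_option maxRecDepth 65536 in
/-- list form of the converse: a box letter with `0 ≤ a` amply below the hub is off-axis with `a ≤ 4`. -/
theorem below_hub_list : ∀ ℓ ∈ boxList 6 6, 0 ≤ ℓ.a → AmpleAbove ℓ hub → ℓ.a ≤ 4 ∧ ℓ.x ≠ 0 ∧ ℓ.y ≠ 0 := by
  decide

/-- BELOW(H) = exactly the off-axis alphabet letters with `a ≤ 4` (the P-able shapes). -/
theorem below_hub_offaxis : ∀ ℓ : Letter, ℓ.OnAlphabet 6 → AmpleAbove ℓ hub → ℓ.a ≤ 4 ∧ ℓ.x ≠ 0 ∧ ℓ.y ≠ 0 := by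
  intro ℓ hℓ hA
  exact below_hub_list ℓ (alphabet_mem_boxList hℓ) hℓ.2 hA

set_option maxRecDepth 65536 in
/-- list form: every off-axis box letter with `0 ≤ a ≤ 3` is amply below SOME letter of shape `(5;1,0)` (the sub-hub F). -/
theorem subhub_above_list : ∀ ℓ ∈ boxList 6 6, 0 ≤ ℓ.a → ℓ.a ≤ 3 → ℓ.x ≠ 0 → ℓ.y ≠ 0 →
    AmpleAbove ℓ ⟨5, 1, 0⟩ ∨ AmpleAbove ℓ ⟨5, -1, 0⟩ ∨ AmpleAbove ℓ ⟨5, 0, 1⟩ ∨ AmpleAbove ℓ ⟨5, 0, -1⟩ := by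
  decide

/-- the sub-hub: every off-axis alphabet letter with `a ≤ 3` lies amply below a letter of shape `F = (5;1,0)`. -/
theorem subhub_above : ∀ ℓ : Letter, ℓ.OnAlphabet 6 → ℓ.a ≤ 3 → ℓ.x ≠ 0 → ℓ.y ≠ 0 →
    AmpleAbove ℓ ⟨5, 1, 0⟩ ∨ AmpleAbove ℓ ⟨5, -1, 0⟩ ∨ AmpleAbove ℓ ⟨5, 0, 1⟩ ∨ AmpleAbove ℓ ⟨5, 0, -1⟩ := by
  intro ℓ hℓ h3 hx hy
  exact subhub_above_list ℓ (alphabet_mem_boxList hℓ) hℓ.2 h3 hx hy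

/-! ## Design level -/

/-- **`H⁴` is live above every present P cell** of an (A4) design on the height-6 alphabet. -/
theorem hub4_live : ∀ D : Design, D.OnAlphabet 6 → D.A4 → ∀ x ∈ D.suppP, Live x hub4 := by
  intro D hA h4 x hx f
  have hxA : (x f).OnAlphabet 6 := hA x (List.mem_append.mpr (Or.inr hx)) f
  have hoff := p_letter_offaxis hA h4 hx f
  have hle := p_letter_le hA h4 hx f
  have hx0 : (x f).x ≠ 0 := fun h0 => hoff (by rw [h0]; ring)
  have hy0 : (x f).y ≠ 0 := fun h0 => hoff (by rw [h0]; ring)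
  exact hub_above (x f) hxA (by omega) hx0 hy0

/-- `H⁴` is live above every cell whose letters are off-axis alphabet letters with `a ≤ 4` (no design hypothesis). -/
theorem hub4_live_of_offaxis (x : Cell) (hx : ∀ f : Fin 4, (x f).OnAlphabet 6 ∧ (x f).a ≤ 4 ∧ (x f).x ≠ 0 ∧ (x f).y ≠ 0) :
    Live x hub4 :=
  fun f => hub_above (x f) (hx f).1 (hx f).2.1 (hx f).2.2.1 (hx f).2.2.2

/-- hence the P-half of (A4) is AUTOMATIC for a design on the height-6 alphabet whose N support contains `H⁴` and whose P letters are
off-axis with `a ≤ 4` (the converse direction `p_letter_offaxis` ∕ `p_letter_le` is in `FinCheck`): (A4).1 carries no information beyond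
«P letters are P-able» once the hub cell is present. -/
theorem a4P_of_hub4 {D : Design} (hA : D.OnAlphabet 6) (hH : hub4 ∈ D.suppN)
    (hP : ∀ x ∈ D.suppP, ∀ f : Fin 4, (x f).a ≤ 4 ∧ (x f).x ≠ 0 ∧ (x f).y ≠ 0) :
    ∀ x ∈ D.suppP, ∃ y ∈ D.suppN, Live x y :=
  fun x hx => ⟨hub4, hH, hub4_live_of_offaxis x fun f =>
    ⟨hA x (List.mem_append.mpr (Or.inr hx)) f, (hP x hx f).1, (hP x hx f).2.1, (hP x hx f).2.2⟩⟩

end Summit.HodgeConjecture.HodgeConjecture.Cruxes.BlochSeedDiscOne.HubCover
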